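import Summits.AtomisticToContinuum.BoseEinsteinCondensation.Theorems.BECThomsonPrincipleDensityResponseComposition
import Summits.AtomisticToContinuum.BoseEinsteinCondensation.Theorems.BECThomsonPrincipleDensityResponseTruncationLimitHardCore

/-!
# Route `BECThomsonPrinciple`, crux `DensityResponse` (stmt-AtomisticToContinuum-9481),
# line `force-balance-constitutive` — the composition AT a potential: crux ⇐ constitutive core ∧ (truncation limit for exotic profiles)

Sequel of `…Composition.lean` (`stub_reduction : ConstitutiveCore → TruncationLimit → DensityResponse`). The truncation limit S4
is now a theorem of the tree for every INTEGRABLE profile (`stub_truncationLimit_integrable`, `…TruncationLimit.lean`) and for every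
SOLID HARD CORE with integrable tail on boxes `L > 2a` (`stub_truncationLimitHardCore`, `…TruncationLimitHardCore.lean`, via the
Literature theorems `periodicGroundStateEnergy_le_maxForm[_of_hardCore]`). This file runs the line's composition one potential at a
time, above a box-size threshold `L₀(v)` absorbed into the diluteness constant (`ρ₀ ≤ (L₀+1)⁻³`, `N₀ ≥ 1` force `L > L₀`), so that the
truncation limit is needed only AT the given `v`:

* `TruncationLimitAt v L₀`, `IsSolidHardCore v`, `TruncationLimitExotic` (the truncation limit for the remaining, EXOTIC, admissible
  profiles: neither `L¹` nor solid-hard-core-plus-`L¹`-tail — e.g. `+∞` on a fat Cantor set of radii; a capacity-theoretic statement,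
  Adams–Hedberg Thm 9.1.3, needed for no physical potential);
* `body_of_ineqs_at` — the composition of `…Composition.lean` with `TruncationLimitAt v L₀` in place of the global S4;
* `exists_truncationLimitAt` — the three-way split (integrable / solid hard core / exotic);
* `stub_reduction3 : ConstitutiveCore → TruncationLimitExotic → DensityResponse` — registered sub-goal: **the crux is closed modulo its
  constitutive core S2 and, for exotic profiles only, the capacity-theoretic truncation limit.** For every `L¹` profile and every solid
  hard core with `L¹` tail (the Lieb–Yngvason class) the crux is closed modulo S2 alone (`densityResponseAt_of_core`).
-/

namespace Summit.AtomisticToContinuum.BoseEinsteinCondensation.Cruxes.DensityResponse.ForceBalanceConstitutive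

open MeasureTheory
open scoped ENNReal
open Literature.MathematicalPhysics.QuantumManyBody.BoseGas
open Summit.AtomisticToContinuum.BoseEinsteinCondensation.Theses

noncomputable section

/-- **Truncation limit AT the potential `v` above the box-size threshold `L₀`**: for `L > L₀` (and `L > 0`),
`E₀^per(min(v,n),N,L) ↑ E₀^per(v,N,L)` whenever the latter is finite (the ε–n₁ form of S4, localised). -/
def TruncationLimitAt (v : ℝ → ℝ≥0∞) (L₀ : ℝ) : Prop :=
  ∀ (N : ℕ) (L : ℝ), 0 < L → L₀ < L → periodicGroundStateEnergy v N L ≠ ⊤ →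
    ∀ ε : ℝ, 0 < ε → ∃ n₁ : ℕ, ∀ n : ℕ, n₁ ≤ n →
      (periodicGroundStateEnergy v N L).toReal ≤ (periodicGroundStateEnergy (truncPotential v n) N L).toReal + ε

/-- **Solid hard core with integrable tail** (the Lieb–Yngvason class beyond `L¹`): `v = +∞` on `[0, a]` for some `a > 0` and
`∫_{ℝ³} (v 𝟙_{(a,∞)})(|z|) dz < ∞`. -/
def IsSolidHardCore (v : ℝ → ℝ≥0∞) : Prop :=
  ∃ a : ℝ, 0 < a ∧ (∀ r : ℝ, 0 ≤ r → r ≤ a → v r = ⊤) ∧ (∫⁻ z : Space, (Set.Ioi a).indicator v ‖z‖) ≠ ⊤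

/-- **S4'' — the truncation limit for EXOTIC admissible profiles**: admissible `v` that are neither integrable on `ℝ³` nor a solid hard
core with integrable tail (e.g. `+∞` on a fat Cantor set of radii, or a non-integrable shell singularity). For such `v` the fixed-volume
statement `E₀^per(min(v,n)) ↑ E₀^per(v)` is the density of the `C¹` Bose core in the maximal form, a capacity-theoretic question
(Adams–Hedberg Thm 9.1.3); no physical pair potential is exotic. The last open piece of S4. -/
def TruncationLimitExotic : Prop :=
  ∀ v : ℝ → ℝ≥0∞, IsRepulsiveFiniteRange v → (∫⁻ z : Space, v ‖z‖) = ⊤ → ¬ IsSolidHardCore v → TruncationLimitAt v 0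

/-- Integrable profiles satisfy the truncation limit at every box size (tree theorem `truncationLimit_at_of_integrable_profile`). -/
theorem truncationLimitAt_of_integrable {v : ℝ → ℝ≥0∞} (hv : IsRepulsiveFiniteRange v) (hint : (∫⁻ z : Space, v ‖z‖) ≠ ⊤) :
    TruncationLimitAt v 0 :=
  fun _N _L hL _ hfin _ε hε => truncationLimit_at_of_integrable_profile hv hint hL hfin hε

/-- Solid hard cores satisfy the truncation limit above the threshold `2a` (tree theorem `truncationLimit_at_of_hardCore_profile`). -/
theorem truncationLimitAt_of_isSolidHardCore {v : ℝ → ℝ≥0∞} (hv : IsRepulsiveFiniteRange v) (h : IsSolidHardCore v) :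
    ∃ L₀ : ℝ, 0 ≤ L₀ ∧ TruncationLimitAt v L₀ := by
  obtain ⟨a, ha, hcoreV, hint⟩ := h
  exact ⟨2 * a, by positivity, fun _N _L hL haL hfin _ε hε =>
    truncationLimit_at_of_hardCore_profile hv ha hcoreV hint hL haL hfin hε⟩

/-- **The three-way split**: given the exotic stub, EVERY admissible profile satisfies the truncation limit above some threshold. -/
theorem exists_truncationLimitAt (h : TruncationLimitExotic) {v : ℝ → ℝ≥0∞} (hv : IsRepulsiveFiniteRange v) :
    ∃ L₀ : ℝ, 0 ≤ L₀ ∧ TruncationLimitAt v L₀ := by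
  by_cases hint : (∫⁻ z : Space, v ‖z‖) = ⊤
  · by_cases hhc : IsSolidHardCore v
    · exact truncationLimitAt_of_isSolidHardCore hv hhc
    · exact ⟨0, le_rfl, h v hv hint hhc⟩
  · exact ⟨0, le_rfl, truncationLimitAt_of_integrable hv hint⟩

/-- **The composition AT a potential** (`body_of_ineqs` of `…Composition.lean` with the truncation limit localised): S1, the
truncation limit at `v` above `L₀`, and the two regime inequalities for the truncations `v_t`, `t ≥ t₀`, give the crux body for
`(v, M)` with `ρ₀ := min(ρ₂, ρ₃, (L₀+1)⁻³)` and `N₀ := max(N₂, N₃, 1)` — which force `L > L₀` for every admissible `(N, L)`. -/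
theorem body_of_ineqs_at (h₁ : TransportStationary) {v : ℝ → ℝ≥0∞} (hv : IsRepulsiveFiniteRange v) {L₀ : ℝ}
    (hL₀ : 0 ≤ L₀) (h₄ : TruncationLimitAt v L₀) {M ρ₂ κ C₁ ρ₃ C' : ℝ} (hρ₂ : 0 < ρ₂) (hκ : 0 < κ) (hρ₃ : 0 < ρ₃)
    {N₂ t₂ N₃ t₃ : ℕ}
    (hcore : ∀ t : ℕ, t₂ ≤ t → CoreIneq (truncPotential v t) (scatteringLength v).toReal M ρ₂ κ C₁ N₂)
    (hkin : ∀ t : ℕ, t₃ ≤ t → KinIneq (truncPotential v t) (scatteringLength v).toReal M ρ₃ C' N₃) :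
    ∃ ρ₀ C : ℝ, 0 < ρ₀ ∧ 0 < C ∧ ∃ N₀ : ℕ, ∀ N : ℕ, N₀ ≤ N → ∀ L : ℝ, 0 < L → (N : ℝ) ≤ ρ₀ * L ^ 3 →
      ∀ n : Fin 3 → ℤ, n ≠ 0 → 2 * Real.pi * ‖(fun j => (n j : ℝ))‖ / L ≤ M * Real.sqrt (N / L ^ 3) →
      ∀ s : ℝ, 0 ≤ s → ∀ Φ : PeriodicTrialState N L,
        periodicGroundStateEnergy v N L + ENNReal.ofReal (s * |∫ X in cellN N L,
            (∑ i, 2 * Real.cos (2 * Real.pi / L * ∑ j, (n j : ℝ) * X i j)) * ‖Φ.ψ X‖ ^ 2|)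
          ≤ periodicEnergy v Φ + ENNReal.ofReal (C * s ^ 2 * N /
              ((2 * Real.pi * ‖(fun j => (n j : ℝ))‖ / L) ^ 2 + N / L ^ 3 * (scatteringLength v).toReal)) := by
  -- constants
  have hθpos : 0 < min 1 (4 * κ) := lt_min one_pos (by linarith)
  have hθ1 : min 1 (4 * κ) ≤ 1 := min_le_left _ _
  have hθκ : min 1 (4 * κ) ≤ 4 * κ := min_le_right _ _
  have hC4 : (4 : ℝ) ≤ max (max (4 * (2 + C₁) / min 1 (4 * κ)) (8 * (2 + C'))) 4 := le_max_right _ _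
  have hCcoreC : 4 * (2 + C₁) / min 1 (4 * κ) ≤ max (max (4 * (2 + C₁) / min 1 (4 * κ)) (8 * (2 + C'))) 4 :=
    (le_max_left _ _).trans (le_max_left _ _)
  have hCkinC : 8 * (2 + C') ≤ max (max (4 * (2 + C₁) / min 1 (4 * κ)) (8 * (2 + C'))) 4 :=
    (le_max_right _ _).trans (le_max_left _ _)
  have hρL : (0 : ℝ) < ((L₀ + 1) ^ 3)⁻¹ := by positivity
  refine ⟨min (min ρ₂ ρ₃) ((L₀ + 1) ^ 3)⁻¹, max (max (4 * (2 + C₁) / min 1 (4 * κ)) (8 * (2 + C'))) 4,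
    lt_min (lt_min hρ₂ hρ₃) hρL, lt_of_lt_of_le (by norm_num) hC4, max (max N₂ N₃) 1, ?_⟩
  generalize max (max (4 * (2 + C₁) / min 1 (4 * κ)) (8 * (2 + C'))) 4 = C at hC4 hCcoreC hCkinC
  intro N hN L hL hNL n hn hwin s hs Φ
  change periodicGroundStateEnergy v N L + ENNReal.ofReal (s * |sourceMean n Φ|) ≤
    periodicEnergy v Φ + ENNReal.ofReal (C * s ^ 2 * N /
      ((2 * Real.pi * ‖(fun j => (n j : ℝ))‖ / L) ^ 2 + N / L ^ 3 * (scatteringLength v).toReal))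
  have hN₂ : N₂ ≤ N := ((le_max_left _ _).trans (le_max_left _ _)).trans hN
  have hN₃ : N₃ ≤ N := ((le_max_right _ _).trans (le_max_left _ _)).trans hN
  have hN1 : 1 ≤ N := (le_max_right _ _).trans hN
  have hL3 : (0 : ℝ) ≤ L ^ 3 := by positivity
  have hNL₂ : (N : ℝ) ≤ ρ₂ * L ^ 3 :=
    hNL.trans (mul_le_mul_of_nonneg_right ((min_le_left _ _).trans (min_le_left _ _)) hL3)
  have hNL₃ : (N : ℝ) ≤ ρ₃ * L ^ 3 :=
    hNL.trans (mul_le_mul_of_nonneg_right ((min_le_left _ _).trans (min_le_right _ _)) hL3)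
  -- the box is larger than the threshold `L₀`
  have hLL₀ : L₀ < L := by
    have h1 : (1 : ℝ) ≤ N := by exact_mod_cast hN1
    have h2 : (N : ℝ) ≤ ((L₀ + 1) ^ 3)⁻¹ * L ^ 3 := hNL.trans (mul_le_mul_of_nonneg_right (min_le_right _ _) hL3)
    have h3 : (L₀ + 1) ^ 3 ≤ L ^ 3 := by
      have h4 : (0 : ℝ) < (L₀ + 1) ^ 3 := by positivity
      have h5 : 1 ≤ ((L₀ + 1) ^ 3)⁻¹ * L ^ 3 := h1.trans h2
      rw [← div_eq_inv_mul, le_div_iff₀ h4] at h5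
      linarith
    have h6 : L₀ + 1 ≤ L := le_of_pow_le_pow_left₀ (by norm_num) hL.le h3
    linarith
  -- signs
  have hNnn : (0 : ℝ) ≤ N := Nat.cast_nonneg N
  have hρa0 : 0 ≤ (N : ℝ) / L ^ 3 * (scatteringLength v).toReal := by positivity
  have hnR : (fun j => (n j : ℝ)) ≠ 0 := by
    intro h0
    apply hn
    funext j
    have h1 : (n j : ℝ) = 0 := by simpa using congrFun h0 j
    show n j = 0
    exact_mod_cast h1
  have hqs0 : 0 < (2 * Real.pi * ‖(fun j => (n j : ℝ))‖ / L) ^ 2 := by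
    have := norm_pos_iff.mpr hnR
    positivity
  have hT0 : 0 ≤ C * s ^ 2 * N /
      ((2 * Real.pi * ‖(fun j => (n j : ℝ))‖ / L) ^ 2 + N / L ^ 3 * (scatteringLength v).toReal) := by
    have : (0 : ℝ) ≤ C := by linarith
    positivity
  have habs : |sourceMean n Φ| ≤ 2 * N := abs_sourceMean_le n Φ
  have hq : (2 * Real.pi * ‖(fun j => (n j : ℝ))‖ / L) ^ 2 ≤ ksq L n := ksupSq_le_ksq L n
  -- infinite energy: nothing to prove
  by_cases hE : periodicEnergy v Φ = ⊤
  · rw [hE, top_add]; exact le_top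
  have hE₀ : periodicGroundStateEnergy v N L ≠ ⊤ :=
    ne_top_of_le_ne_top hE (periodicGroundStateEnergy_le v Φ)
  -- the real chord suffices
  suffices hreal : (periodicGroundStateEnergy v N L).toReal - C * s ^ 2 * N /
      ((2 * Real.pi * ‖(fun j => (n j : ℝ))‖ / L) ^ 2 + N / L ^ 3 * (scatteringLength v).toReal) ≤
      (periodicEnergy v Φ).toReal - s * |sourceMean n Φ| by
    rw [(ENNReal.ofReal_toReal hE₀).symm, (ENNReal.ofReal_toReal hE).symm,
      ← ENNReal.ofReal_add ENNReal.toReal_nonneg (by positivity),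
      ← ENNReal.ofReal_add ENNReal.toReal_nonneg hT0]
    exact ENNReal.ofReal_le_ofReal (by linarith)
  -- … and it is proved up to every `ε > 0` through a tall truncation of `v`
  refine le_of_forall_pos_le_add fun ε hε => ?_
  obtain ⟨t₁, ht₁⟩ := h₄ N L hL hLL₀ hE₀ ε hε
  obtain ⟨t, ht₂, ht₃, htt₁⟩ : ∃ t : ℕ, t₂ ≤ t ∧ t₃ ≤ t ∧ t₁ ≤ t :=
    ⟨max (max t₂ t₃) t₁, (le_max_left _ _).trans (le_max_left _ _),
      (le_max_right _ _).trans (le_max_left _ _), le_max_right _ _⟩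
  have hw : IsRepulsiveFiniteRange (truncPotential v t) := isRepulsiveFiniteRange_truncPotential hv t
  have hwb : ∃ B : ℝ, ∀ r, truncPotential v t r ≤ ENNReal.ofReal B := ⟨t, truncPotential_le_ofReal v t⟩
  have hEwΦ_le : periodicEnergy (truncPotential v t) Φ ≤ periodicEnergy v Φ :=
    periodicEnergy_truncPotential_le v t Φ
  have hEwΦ : periodicEnergy (truncPotential v t) Φ ≠ ⊤ := ne_top_of_le_ne_top hE hEwΦ_le
  have hEwΦr : (periodicEnergy (truncPotential v t) Φ).toReal ≤ (periodicEnergy v Φ).toReal :=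
    ENNReal.toReal_mono hE hEwΦ_le
  have hE₀wr : (periodicGroundStateEnergy (truncPotential v t) N L).toReal ≤
      (periodicEnergy (truncPotential v t) Φ).toReal :=
    ENNReal.toReal_mono hEwΦ (periodicGroundStateEnergy_le _ Φ)
  have hlim : (periodicGroundStateEnergy v N L).toReal ≤
      (periodicGroundStateEnergy (truncPotential v t) N L).toReal + ε := ht₁ t htt₁
  -- S1: the transport-stationary normal form for the truncated potential
  obtain ⟨Φ', hE', hdrive, hstat⟩ := h₁ N L (truncPotential v t) hw hwb hL n hn s hs Φ hEwΦ
  have hE₀E' : (periodicGroundStateEnergy (truncPotential v t) N L).toReal ≤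
      (periodicEnergy (truncPotential v t) Φ').toReal :=
    ENNReal.toReal_mono hE' (periodicGroundStateEnergy_le _ Φ')
  have hstat' : kineticStressWave n Φ' + ksq L n / 4 * sourceMean n Φ' + virialWave (truncPotential v t) n Φ' =
      s * effNumber n Φ' := hstat
  -- the chord for the truncated potential (closing algebra fed by the two regime inequalities at `Φ'`)
  have key := real_chord hs hNnn hqs0 hρa0 hq hθpos hθ1 hθκ hC4 hCcoreC hCkinC habs (effNumber_le n Φ')
    hE₀E' hE₀wr hdrive hstat'
    (fun hsmall hsub hnn => hcore t ht₂ N hN₂ L hL hNL₂ n hn hwin s hs hsmall Φ' hE' hstat hsub hnn)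
    (fun hlarge hsub => hkin t ht₃ N hN₃ L hL hNL₃ n hn hwin s hs hlarge Φ' hE' hstat hsub)
  linarith

/-- The crux body at ONE potential from the constitutive core and a localised truncation limit (S1, S3a, S3b are tree theorems). -/
theorem densityResponseAt_of_core_of_truncationLimitAt (h₂ : ConstitutiveCore) {v : ℝ → ℝ≥0∞} (hv : IsRepulsiveFiniteRange v)
    {L₀ : ℝ} (hL₀ : 0 ≤ L₀) (h₄ : TruncationLimitAt v L₀) {M : ℝ} (hM : 0 < M) :
    ∃ ρ₀ C : ℝ, 0 < ρ₀ ∧ 0 < C ∧ ∃ N₀ : ℕ, ∀ N : ℕ, N₀ ≤ N → ∀ L : ℝ, 0 < L → (N : ℝ) ≤ ρ₀ * L ^ 3 →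
      ∀ n : Fin 3 → ℤ, n ≠ 0 → 2 * Real.pi * ‖(fun j => (n j : ℝ))‖ / L ≤ M * Real.sqrt (N / L ^ 3) →
      ∀ s : ℝ, 0 ≤ s → ∀ Φ : PeriodicTrialState N L,
        periodicGroundStateEnergy v N L + ENNReal.ofReal (s * |∫ X in cellN N L,
            (∑ i, 2 * Real.cos (2 * Real.pi / L * ∑ j, (n j : ℝ) * X i j)) * ‖Φ.ψ X‖ ^ 2|)
          ≤ periodicEnergy v Φ + ENNReal.ofReal (C * s ^ 2 * N /
              ((2 * Real.pi * ‖(fun j => (n j : ℝ))‖ / L) ^ 2 + N / L ^ 3 * (scatteringLength v).toReal)) := by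
  obtain ⟨ρ₂, κ, C₁, hρ₂, hκ, -, N₂, t₂, hcore⟩ := h₂ v hv M hM
  by_cases hb : ∃ B : ℝ, ∀ r, v r ≤ ENNReal.ofReal B
  · obtain ⟨ρ₃, C', hρ₃, -, N₃, hkin⟩ := stub_kineticSignCoherenceBounded v hv hb M hM
    obtain ⟨B, hB⟩ := hb
    refine body_of_ineqs_at stub_transportStationary hv hL₀ h₄ hρ₂ hκ hρ₃ hcore (C' := C') (N₃ := N₃)
      (t₃ := ⌈B⌉₊) fun t ht => ?_
    rw [truncPotential_eq_self_of_le hB (Nat.ceil_le.mp ht)]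
    exact hkin
  · have hub : ∀ B : ℝ, ∃ r, ENNReal.ofReal B < v r := by
      intro B
      by_contra h
      push Not at h
      exact hb ⟨B, h⟩
    obtain ⟨ρ₃, C', hρ₃, -, N₃, t₃, hkin⟩ := stub_kineticSignCoherenceUnbounded v hv hub M hM
    exact body_of_ineqs_at stub_transportStationary hv hL₀ h₄ hρ₂ hκ hρ₃ hcore hkin

/-- **For the Lieb–Yngvason class the crux is closed modulo S2 alone**: integrable profiles and solid hard cores with integrable tail
need no exotic stub. -/
theorem densityResponseAt_of_core (h₂ : ConstitutiveCore) {v : ℝ → ℝ≥0∞} (hv : IsRepulsiveFiniteRange v)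
    (hclass : (∫⁻ z : Space, v ‖z‖) ≠ ⊤ ∨ IsSolidHardCore v) {M : ℝ} (hM : 0 < M) :
    ∃ ρ₀ C : ℝ, 0 < ρ₀ ∧ 0 < C ∧ ∃ N₀ : ℕ, ∀ N : ℕ, N₀ ≤ N → ∀ L : ℝ, 0 < L → (N : ℝ) ≤ ρ₀ * L ^ 3 →
      ∀ n : Fin 3 → ℤ, n ≠ 0 → 2 * Real.pi * ‖(fun j => (n j : ℝ))‖ / L ≤ M * Real.sqrt (N / L ^ 3) →
      ∀ s : ℝ, 0 ≤ s → ∀ Φ : PeriodicTrialState N L,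
        periodicGroundStateEnergy v N L + ENNReal.ofReal (s * |∫ X in cellN N L,
            (∑ i, 2 * Real.cos (2 * Real.pi / L * ∑ j, (n j : ℝ) * X i j)) * ‖Φ.ψ X‖ ^ 2|)
          ≤ periodicEnergy v Φ + ENNReal.ofReal (C * s ^ 2 * N /
              ((2 * Real.pi * ‖(fun j => (n j : ℝ))‖ / L) ^ 2 + N / L ^ 3 * (scatteringLength v).toReal)) := by
  rcases hclass with hint | hhc
  · exact densityResponseAt_of_core_of_truncationLimitAt h₂ hv le_rfl (truncationLimitAt_of_integrable hv hint) hM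
  · obtain ⟨L₀, hL₀, h₄⟩ := truncationLimitAt_of_isSolidHardCore hv hhc
    exact densityResponseAt_of_core_of_truncationLimitAt h₂ hv hL₀ h₄ hM

/-- **Registered sub-goal `stub_reduction3`: the crux modulo its constitutive core and the exotic truncation limit.** [folklore] -/
theorem stub_reduction3 : ConstitutiveCore → TruncationLimitExotic → BECThomsonPrinciple.DensityResponse := by
  intro h₂ h₄'' v hv M hM
  obtain ⟨L₀, hL₀, h₄⟩ := exists_truncationLimitAt h₄'' hv
  exact densityResponseAt_of_core_of_truncationLimitAt h₂ hv hL₀ h₄ hM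

end

end Summit.AtomisticToContinuum.BoseEinsteinCondensation.Cruxes.DensityResponse.ForceBalanceConstitutive
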